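import Summits.CriticalPhenomena.PercolationContinuityZ3.Theorems.PercNearOneGluingNoHeavyLowerTailKnQuestion8CoefficientwiseNoCoreBase
import HarnessLib

/-!
# Contracting a root edge: the NO-CORE sum of `G/e` and the reduction of CONJECTURE NO-CORE to the ROOT-CONTRACTION inequality — prim-lf-2 gen 56

Support file (`--supports stmt-CriticalPhenomena-4575`, closed), prover `prim-lf-2` (gen 56).  No definitions, no named facts, no sorries; standard axioms.
Memo `prim-lf-2/CW-DELCON-gen56.md`.

Setting (as in `…CoefficientwiseNoCoreBase.lean`): a finite multigraph `ends : ι → Sym2 V`, an edge set `E`, root `x`, target `y`; for a colouring `s ⊆ E` (the red edges)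
`C_x(s) = openCluster (ends '' s) x`, and
  `NC_E(x,y)[f,g] := Σ_{s ⊆ E : ¬(y ∈ C_x(s) ∧ y ∈ C_x(E∖s))} (f(C_x s) − f(C_x(E∖s)))·(g(C_x s) − g(C_x(E∖s)))`   (CONJECTURE NO-CORE: `≥ 0` for monotone `f, g`).
Contraction.  For an edge `e ∈ E` with ends `{x, p}`, `p ≠ x`, the contracted multigraph `G/e` is `ends' := Sym2.map c ∘ ends` on the edge set `E.erase e`, where `c` sends `p` to `x`
and fixes every other vertex (edges parallel to `e` become loops at `x`, which clusters ignore).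
* `Coefficientwise.mem_openCluster_contract_iff` — clusters of the contraction: `v ∈ C'_x(s) ↔ v ≠ p ∧ v ∈ C_x(insert e s)`; hence `insert p (C'_x s) = C_x(insert e s)`
  (`openCluster_contract_insert`): contracting `e` is the same as declaring `e` open.
* `Coefficientwise.noCore_contract_eq` — the NO-CORE sum of `G/e` (root `x`, target `y ≠ p`, functions `X ↦ f(insert p X)`) equals the 'doubly open' sum on `G`:
  `NC_{E.erase e}'(x,y)[f(insert p ·), g(insert p ·)] = Σ_{s ⊆ E∖e : ¬(y ∈ C_x(s+e) ∧ y ∈ C_x(E∖s))} (f(C_x(s+e)) − f(C_x(E∖s)))·(g(C_x(s+e)) − g(C_x(E∖s)))`.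
* `Coefficientwise.noCore_of_rootContraction` — **REDUCTION THEOREM.**  If the ROOT-CONTRACTION inequality
  `(RC)  NC_E(x,y)[f,g] ≥ Σ_{s ⊆ E∖e : ¬(y ∈ C_x(s+e) ∧ y ∈ C_x(E∖s))} (f(C_x(s+e)) − f(C_x(E∖s)))·(g(C_x(s+e)) − g(C_x(E∖s)))`
  holds for every multigraph on the edge/vertex types `ι, V`, every root edge `e = {x,p}` (`p ≠ x`), every target `y ∉ {x,p}` not adjacent to `x`, and all monotone `f, g`, then
  CONJECTURE NO-CORE holds for every multigraph on `ι, V`: `0 ≤ NC_E(x,y)[f,g]` for all `E, x, y ≠ x` and monotone `f, g`.  Proof: induction on `|E|`; if `x ∼ y` this is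
  `noCore_powerset_of_adj_root` (NO-CORE = 2·OFF, gen 46/55); if `x` meets only loops every cluster of `x` is `{x}` and the sum vanishes; otherwise a root edge `e = {x,p}`, `p ≠ y`,
  gives `NC_E ≥ NC_{G/e} ≥ 0` by (RC), `noCore_contract_eq` and the induction hypothesis for the contraction (one edge fewer; `X ↦ f(insert p X)` is monotone).
Census behind (RC) (prim-lf-2 gen 56, code/gen56): exact minimum over ALL monotone pairs `(f,g)` (all up-sets of `2^{V∖x}` for `f`, min-weight up-set for `g`): every root edge of every
connected simple graph on ≤ 5 vertices (5 352 non-`y` edges incl. 2 280 root edges, coefficientwise AND for independent `p`-copies, `p ∈ {0.1,…,0.9}`), every root edge of the 13 287 connected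
multigraphs on 5 vertices with edge multiplicities ≤ 2 and ≤ 8 edges (59 652 root edges): 0 failures (the inequality fails for edges AT `y`).  The raw-sum form matters: `G` has twice as
many colourings as `G/e`, so (RC) says `ν(G/e) ≤ 2ν(G)` for the normalised sums; the stronger deletion–contraction form `NC(G) ≥ NC(G−e) + NC(G/e)` (exact for the unconstrained
Harris sum, where it is the concavity of a covariance in one edge parameter) is FALSE as a universal single-edge rule (720 of 62 120 `(G,y)` on 6 vertices have no such edge).
[cite: KozmaNitzan2024, Questions 8–9 (§5.5 p. 36) (context: the Question-8 pocket covariance programme)]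
-/

namespace Summit.CriticalPhenomena.PercolationContinuityZ3.Theorems

open Finset Literature.Probability.Percolation

namespace Coefficientwise

variable {ι V : Type*}

section contraction

variable [DecidableEq V]

/-- The contraction map `c = Function.update id p x` fixes every vertex other than `p`. [cite: KozmaNitzan2024, §5.5 (context only; folklore)] -/
theorem contractMap_of_ne {x p v : V} (hv : v ≠ p) : Function.update id p x v = v := by
  rw [Function.update_of_ne hv]; rfl

/-- The contraction map sends `p` to `x`. [cite: KozmaNitzan2024, §5.5 (context only; folklore)] -/
theorem contractMap_self (x p : V) : Function.update id p x p = x := by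
  rw [Function.update_self]

/-- Forward transfer: a red path from `x` in `G` with `e = {x,p}` red maps, under the contraction `c`, to a red path of `G/e`.
[cite: KozmaNitzan2024, §5.5 (context only; folklore)] -/
theorem reachable_contract_of_reachable_insert [DecidableEq ι] (ends : ι → Sym2 V) (s : Finset ι) {e : ι} {x p : V}
    (hxp : ends e = s(x, p)) (hpx : p ≠ x) {v : V}
    (hv : (openGraph (ends '' (↑(insert e s) : Set ι))).Reachable x v) :
    (openGraph ((fun i => Sym2.map (Function.update id p x) (ends i)) '' (↑s : Set ι))).Reachable x (Function.update id p x v) := by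
  set c : V → V := Function.update id p x with hc
  have hcx : c x = x := contractMap_of_ne hpx.symm
  rw [SimpleGraph.reachable_iff_reflTransGen] at hv
  induction hv with
  | refl => rw [hcx]
  | @tail u w _ huw ih =>
    rw [openGraph_image_adj] at huw
    obtain ⟨⟨i, hi, hiuw⟩, hne⟩ := huw
    by_cases hcuw : c u = c w
    · rw [← hcuw]; exact ih
    · have hie : i ≠ e := by
        rintro rfl
        rw [hxp] at hiuw
        -- {x,p} = {u,w} forces c u = c w = x
        have hu : u ∈ s(x, p) := by rw [hiuw]; exact Sym2.mem_mk_left u w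
        have hw : w ∈ s(x, p) := by rw [hiuw]; exact Sym2.mem_mk_right u w
        have hcu : c u = x := by
          rcases Sym2.mem_iff.mp hu with rfl | rfl
          · exact hcx
          · exact contractMap_self x u
        have hcw : c w = x := by
          rcases Sym2.mem_iff.mp hw with rfl | rfl
          · exact hcx
          · exact contractMap_self x w
        exact hcuw (hcu.trans hcw.symm)
      have his : i ∈ s := by
        rcases Finset.mem_insert.mp hi with h | h
        · exact absurd h hie
        · exact h
      have hadj : (openGraph ((fun i => Sym2.map c (ends i)) '' (↑s : Set ι))).Adj (c u) (c w) := by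
        rw [openGraph_image_adj]
        refine ⟨⟨i, his, ?_⟩, hcuw⟩
        show Sym2.map c (ends i) = s(c u, c w)
        rw [hiuw, Sym2.map_mk]
      exact ih.trans hadj.reachable

/-- Backward transfer: a red path of the contraction `G/e` from `x` lifts to a red path of `G` in which `e = {x,p}` is red.
[cite: KozmaNitzan2024, §5.5 (context only; folklore)] -/
theorem reachable_insert_of_reachable_contract [DecidableEq ι] (ends : ι → Sym2 V) (s : Finset ι) {e : ι} {x p : V}
    (hxp : ends e = s(x, p)) (hpx : p ≠ x) {v : V}
    (hv : (openGraph ((fun i => Sym2.map (Function.update id p x) (ends i)) '' (↑s : Set ι))).Reachable x v) :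
    (openGraph (ends '' (↑(insert e s) : Set ι))).Reachable x v := by
  set c : V → V := Function.update id p x with hc
  set Gr : SimpleGraph V := openGraph (ends '' (↑(insert e s) : Set ι)) with hGr
  -- `c a` is joined to `a` in `G` with `e` red (either `c a = a`, or `a = p` and the edge `e` does it)
  have hlift : ∀ a : V, Gr.Reachable (c a) a := by
    intro a
    by_cases hap : a = p
    · subst hap
      rw [show c a = x from contractMap_self x a]
      have hadj : Gr.Adj x a := by
        rw [hGr, openGraph_image_adj]
        exact ⟨⟨e, Finset.mem_insert_self e s, hxp⟩, hpx.symm⟩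
      exact hadj.reachable
    · rw [show c a = a from contractMap_of_ne hap]
  rw [SimpleGraph.reachable_iff_reflTransGen] at hv
  induction hv with
  | refl => exact SimpleGraph.Reachable.refl x
  | @tail u w _ huw ih =>
    rw [openGraph_image_adj] at huw
    obtain ⟨⟨i, his, hiuw⟩, hne⟩ := huw
    -- ends i = s(a,b) with c a = u, c b = w (up to order)
    have hu : u ∈ Sym2.map c (ends i) := by rw [hiuw]; exact Sym2.mem_mk_left u w
    have hw : w ∈ Sym2.map c (ends i) := by rw [hiuw]; exact Sym2.mem_mk_right u w
    obtain ⟨a, ha, hau⟩ := Sym2.mem_map.mp hu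
    obtain ⟨b, hb, hbw⟩ := Sym2.mem_map.mp hw
    have hab : a ≠ b := by rintro rfl; exact hne (hau.symm.trans hbw)
    have hendi : ends i = s(a, b) := (Sym2.mem_and_mem_iff hab).mp ⟨ha, hb⟩
    have hadj : Gr.Adj a b := by
      rw [hGr, openGraph_image_adj]
      exact ⟨⟨i, Finset.mem_insert_of_mem his, hendi⟩, hab⟩
    have huw' : Gr.Reachable u w := by
      rw [← hau, ← hbw]
      exact ((hlift a).trans hadj.reachable).trans (hlift b).symm
    exact ih.trans huw'

/-- **Clusters of the contraction.**  For `e = {x,p}`, `p ≠ x`, and a colouring `s` of the other edges: `v ∈ C'_x(s)` (cluster of `x` in `G/e`) iff `v ≠ p` and `v ∈ C_x(insert e s)`.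
[cite: KozmaNitzan2024, §5.5 (context only; folklore)] -/
theorem mem_openCluster_contract_iff [DecidableEq ι] (ends : ι → Sym2 V) (s : Finset ι) {e : ι} {x p : V}
    (hxp : ends e = s(x, p)) (hpx : p ≠ x) (v : V) :
    v ∈ openCluster ((fun i => Sym2.map (Function.update id p x) (ends i)) '' (↑s : Set ι)) x ↔
      v ≠ p ∧ v ∈ openCluster (ends '' (↑(insert e s) : Set ι)) x := by
  set c : V → V := Function.update id p x with hc
  constructor
  · intro hv
    refine ⟨?_, reachable_insert_of_reachable_contract ends s hxp hpx hv⟩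
    -- `p` meets no edge of the contraction, so it is not reachable from `x ≠ p`
    rintro rfl
    change (openGraph ((fun i => Sym2.map c (ends i)) '' (↑s : Set ι))).Reachable x v at hv
    rw [SimpleGraph.reachable_iff_reflTransGen] at hv
    rcases Relation.ReflTransGen.cases_tail hv with h | ⟨u, _, huv⟩
    · exact hpx h
    · rw [openGraph_image_adj] at huv
      obtain ⟨⟨i, _, hiuv⟩, _⟩ := huv
      have hvm : v ∈ Sym2.map c (ends i) := by rw [hiuv]; exact Sym2.mem_mk_right u v
      obtain ⟨a, _, hav⟩ := Sym2.mem_map.mp hvm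
      by_cases hap : a = v
      · rw [hap, show c v = x from contractMap_self x v] at hav; exact hpx hav.symm
      · rw [show c a = a from contractMap_of_ne hap] at hav; exact hap hav
  · rintro ⟨hvp, hv⟩
    have h := reachable_contract_of_reachable_insert ends s hxp hpx hv
    rw [show Function.update id p x v = v from contractMap_of_ne hvp] at h
    exact h

/-- Contracting `e = {x,p}` is declaring it open: `insert p (C'_x s) = C_x(insert e s)`. [cite: KozmaNitzan2024, §5.5 (context only; folklore)] -/
theorem openCluster_contract_insert [DecidableEq ι] (ends : ι → Sym2 V) (s : Finset ι) {e : ι} {x p : V}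
    (hxp : ends e = s(x, p)) (hpx : p ≠ x) :
    insert p (openCluster ((fun i => Sym2.map (Function.update id p x) (ends i)) '' (↑s : Set ι)) x) =
      openCluster (ends '' (↑(insert e s) : Set ι)) x := by
  ext v
  rw [Set.mem_insert_iff, mem_openCluster_contract_iff ends s hxp hpx]
  constructor
  · rintro (rfl | ⟨_, h⟩)
    · have hadj : (openGraph (ends '' (↑(insert e s) : Set ι))).Adj x v := by
        rw [openGraph_image_adj]
        exact ⟨⟨e, Finset.mem_insert_self e s, hxp⟩, hpx.symm⟩
      exact hadj.reachable
    · exact h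
  · intro h
    by_cases hvp : v = p
    · exact Or.inl hvp
    · exact Or.inr ⟨hvp, h⟩

end contraction

section sums

variable [DecidableEq ι] [DecidableEq V]

/-- `insert e ((E.erase e) ∖ s) = E ∖ s` for `e ∈ E` and `s ⊆ E.erase e`. [cite: KozmaNitzan2024, §5.5 (context only; folklore)] -/
theorem insert_erase_sdiff {E s : Finset ι} {e : ι} (he : e ∈ E) (hs : s ⊆ E.erase e) : insert e (E.erase e \ s) = E \ s := by
  ext i
  simp only [Finset.mem_insert, Finset.mem_sdiff, Finset.mem_erase]
  constructor
  · rintro (rfl | ⟨⟨_, hiE⟩, his⟩)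
    · exact ⟨he, fun h => (Finset.mem_erase.mp (hs h)).1 rfl⟩
    · exact ⟨hiE, his⟩
  · rintro ⟨hiE, his⟩
    by_cases hie : i = e
    · exact Or.inl hie
    · exact Or.inr ⟨⟨hie, hiE⟩, his⟩

open Classical in
/-- **The NO-CORE sum of the contraction `G/e`.**  For a root edge `e ∈ E` with ends `{x,p}`, `p ≠ x`, and a target `y ≠ p`: the NO-CORE sum of `G/e` (edge set `E.erase e`,
contracted ends, root `x`, functions `X ↦ f(insert p X)`, `X ↦ g(insert p X)`) is the sum over colourings `s ⊆ E.erase e` of `G` with `e` open on BOTH sides.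
[cite: KozmaNitzan2024, Questions 8–9 (§5.5 p. 36) (context)] -/
theorem noCore_contract_eq (ends : ι → Sym2 V) (E : Finset ι) {e : ι} (he : e ∈ E) {x p y : V}
    (hxp : ends e = s(x, p)) (hpx : p ≠ x) (hyp : y ≠ p) (f g : Set V → ℝ) :
    (∑ s ∈ (E.erase e).powerset.filter (fun s : Finset ι =>
        ¬ (y ∈ openCluster ((fun i => Sym2.map (Function.update id p x) (ends i)) '' (↑s : Set ι)) x ∧
           y ∈ openCluster ((fun i => Sym2.map (Function.update id p x) (ends i)) '' (↑(E.erase e \ s) : Set ι)) x)),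
      (f (insert p (openCluster ((fun i => Sym2.map (Function.update id p x) (ends i)) '' (↑s : Set ι)) x)) -
          f (insert p (openCluster ((fun i => Sym2.map (Function.update id p x) (ends i)) '' (↑(E.erase e \ s) : Set ι)) x))) *
        (g (insert p (openCluster ((fun i => Sym2.map (Function.update id p x) (ends i)) '' (↑s : Set ι)) x)) -
          g (insert p (openCluster ((fun i => Sym2.map (Function.update id p x) (ends i)) '' (↑(E.erase e \ s) : Set ι)) x)))) =
    ∑ s ∈ (E.erase e).powerset.filter (fun s : Finset ι =>
        ¬ (y ∈ openCluster (ends '' (↑(insert e s) : Set ι)) x ∧ y ∈ openCluster (ends '' (↑(E \ s) : Set ι)) x)),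
      (f (openCluster (ends '' (↑(insert e s) : Set ι)) x) - f (openCluster (ends '' (↑(E \ s) : Set ι)) x)) *
        (g (openCluster (ends '' (↑(insert e s) : Set ι)) x) - g (openCluster (ends '' (↑(E \ s) : Set ι)) x)) := by
  set ends' : ι → Sym2 V := fun i => Sym2.map (Function.update id p x) (ends i) with hends'
  set K' : Finset ι → Set V := fun s => openCluster (ends' '' (↑s : Set ι)) x with hK'
  set K : Finset ι → Set V := fun s => openCluster (ends '' (↑s : Set ι)) x with hK
  -- the two dictionaries
  have hins : ∀ s : Finset ι, insert p (K' s) = K (insert e s) := fun s => openCluster_contract_insert ends s hxp hpx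
  have hmem : ∀ s : Finset ι, (y ∈ K' s ↔ y ∈ K (insert e s)) := fun s => by
    rw [hK', mem_openCluster_contract_iff ends s hxp hpx y]; exact ⟨fun h => h.2, fun h => ⟨hyp, h⟩⟩
  have hcomp : ∀ s ∈ (E.erase e).powerset, insert e (E.erase e \ s) = E \ s := fun s hs =>
    insert_erase_sdiff he (Finset.mem_powerset.mp hs)
  rw [Finset.sum_filter, Finset.sum_filter]
  refine Finset.sum_congr rfl fun s hs => ?_
  have hs' : E.erase e \ s ∈ (E.erase e).powerset := Finset.mem_powerset.mpr Finset.sdiff_subset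
  have e1 : insert p (K' s) = K (insert e s) := hins s
  have e2 : insert p (K' (E.erase e \ s)) = K (E \ s) := by rw [hins, hcomp s hs]
  have m1 : (y ∈ K' s ↔ y ∈ K (insert e s)) := hmem s
  have m2 : (y ∈ K' (E.erase e \ s) ↔ y ∈ K (E \ s)) := by rw [hmem, hcomp s hs]
  change (if ¬ (y ∈ K' s ∧ y ∈ K' (E.erase e \ s)) then
      (f (insert p (K' s)) - f (insert p (K' (E.erase e \ s)))) * (g (insert p (K' s)) - g (insert p (K' (E.erase e \ s)))) else 0) =
    (if ¬ (y ∈ K (insert e s) ∧ y ∈ K (E \ s)) then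
      (f (K (insert e s)) - f (K (E \ s))) * (g (K (insert e s)) - g (K (E \ s))) else 0)
  rw [e1, e2]
  exact if_congr (not_congr (and_congr m1 m2)) rfl rfl

omit [DecidableEq ι] [DecidableEq V] in
/-- If every edge of `s` at `x` is a loop (or `x` meets no edge of `s`), the red cluster of `x` is `{x}`. [cite: KozmaNitzan2024, §5.5 (context only; folklore)] -/
theorem openCluster_subset_singleton_of_loops (ends : ι → Sym2 V) (s : Finset ι) {x : V}
    (hx : ∀ i ∈ s, ∀ w : V, ends i = s(x, w) → w = x) (v : V)
    (hv : v ∈ openCluster (ends '' (↑s : Set ι)) x) : v = x := by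
  change (openGraph (ends '' (↑s : Set ι))).Reachable x v at hv
  rw [SimpleGraph.reachable_iff_reflTransGen] at hv
  rcases Relation.ReflTransGen.cases_head hv with h | ⟨w, hxw, _⟩
  · exact h.symm
  · rw [openGraph_image_adj] at hxw
    obtain ⟨⟨i, hi, hixw⟩, hne⟩ := hxw
    exact absurd (hx i hi w hixw) hne.symm

open Classical in
/-- **REDUCTION THEOREM: the root-contraction inequality implies CONJECTURE NO-CORE.**  Suppose that for every multigraph `ends : ι → Sym2 V`, every edge set `E`, every root edge
`e ∈ E` with ends `{x,p}` (`p ≠ x`), every target `y ∉ {x,p}` with no edge of `E` joining `x` to `y`, and all monotone `f, g`: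
  `Σ_{s ⊆ E∖e : ¬(y ∈ C_x(s+e) ∧ y ∈ C_x(E∖s))} (f(C_x(s+e)) − f(C_x(E∖s)))(g(C_x(s+e)) − g(C_x(E∖s)))  ≤  NC_E(x,y)[f,g]`   (RC: 'contracting a root edge does not
increase the raw NO-CORE sum'; census-clean for all monotone pairs on all graphs with ≤ 5 vertices, coefficientwise, at law level and on multigraphs).  Then
`0 ≤ NC_E(x,y)[f,g]` for EVERY edge set `E`, root `x`, target `y ≠ x` and monotone `f, g` (CONJECTURE NO-CORE of prim-lf-2 gen 46 on the types `ι, V`).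
[cite: KozmaNitzan2024, Questions 8–9 (§5.5 p. 36) (context)] -/
theorem noCore_of_rootContraction
    (hRC : ∀ (ends : ι → Sym2 V) (E : Finset ι) (e : ι), e ∈ E → ∀ (x p y : V), ends e = s(x, p) → p ≠ x → y ≠ x → y ≠ p →
      (∀ i ∈ E, ends i ≠ s(x, y)) → ∀ (f g : Set V → ℝ), Monotone f → Monotone g →
      (∑ s ∈ (E.erase e).powerset.filter (fun s : Finset ι =>
          ¬ (y ∈ openCluster (ends '' (↑(insert e s) : Set ι)) x ∧ y ∈ openCluster (ends '' (↑(E \ s) : Set ι)) x)),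
        (f (openCluster (ends '' (↑(insert e s) : Set ι)) x) - f (openCluster (ends '' (↑(E \ s) : Set ι)) x)) *
          (g (openCluster (ends '' (↑(insert e s) : Set ι)) x) - g (openCluster (ends '' (↑(E \ s) : Set ι)) x))) ≤
      ∑ s ∈ E.powerset.filter (fun s : Finset ι => ¬ (y ∈ openCluster (ends '' (↑s : Set ι)) x ∧
            y ∈ openCluster (ends '' (↑(E \ s) : Set ι)) x)),
        (f (openCluster (ends '' (↑s : Set ι)) x) - f (openCluster (ends '' (↑(E \ s) : Set ι)) x)) *
          (g (openCluster (ends '' (↑s : Set ι)) x) - g (openCluster (ends '' (↑(E \ s) : Set ι)) x)))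
    (ends : ι → Sym2 V) (E : Finset ι) (x y : V) (hyx : y ≠ x) (f g : Set V → ℝ) (hf : Monotone f) (hg : Monotone g) :
    0 ≤ ∑ s ∈ E.powerset.filter (fun s : Finset ι => ¬ (y ∈ openCluster (ends '' (↑s : Set ι)) x ∧
          y ∈ openCluster (ends '' (↑(E \ s) : Set ι)) x)),
      (f (openCluster (ends '' (↑s : Set ι)) x) - f (openCluster (ends '' (↑(E \ s) : Set ι)) x)) *
        (g (openCluster (ends '' (↑s : Set ι)) x) - g (openCluster (ends '' (↑(E \ s) : Set ι)) x)) := by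
  -- strong induction on the number of edges, for all multigraphs and all monotone pairs
  induction hn : E.card using Nat.strong_induction_on generalizing E ends f g with
  | _ n ih =>
  by_cases hadj : ∃ i ∈ E, ends i = s(x, y)
  · -- `x ∼ y`: NO-CORE = 2·OFF (gen 46/55)
    obtain ⟨i, hi, hixy⟩ := hadj
    exact noCore_powerset_of_adj_root ends E x y hi hixy hyx f g hf hg
  push Not at hadj
  by_cases hroot : ∃ e ∈ E, ∃ p : V, p ≠ x ∧ ends e = s(x, p)
  · -- a proper root edge `e = {x,p}`, `p ≠ y`: contract it
    obtain ⟨e, he, p, hpx, hxp⟩ := hroot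
    have hyp : y ≠ p := by rintro rfl; exact hadj e he hxp
    have hRCe := hRC ends E e he x p y hxp hpx hyx hyp hadj f g hf hg
    refine le_trans ?_ hRCe
    -- the doubly-open sum is the NO-CORE sum of the contraction, nonnegative by induction
    rw [← noCore_contract_eq ends E he hxp hpx hyp f g]
    have hcard : (E.erase e).card < n := by rw [← hn]; exact Finset.card_erase_lt_of_mem he
    have hf' : Monotone (fun X : Set V => f (insert p X)) := fun X Y hXY => hf (Set.insert_subset_insert hXY)
    have hg' : Monotone (fun X : Set V => g (insert p X)) := fun X Y hXY => hg (Set.insert_subset_insert hXY)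
    exact ih _ hcard (fun i => Sym2.map (Function.update id p x) (ends i)) (E.erase e)
      (fun X => f (insert p X)) (fun X => g (insert p X)) hf' hg' rfl
  · -- `x` meets only loops: both clusters are `{x}` and every summand vanishes
    push Not at hroot
    have hloops : ∀ t : Finset ι, t ⊆ E → ∀ i ∈ t, ∀ w : V, ends i = s(x, w) → w = x := by
      intro t ht i hi w hiw
      by_contra hwx
      exact hroot i (ht hi) w hwx hiw
    have hsing : ∀ t : Finset ι, t ⊆ E → openCluster (ends '' (↑t : Set ι)) x = {x} := by
      intro t ht
      ext v
      simp only [Set.mem_singleton_iff]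
      exact ⟨openCluster_subset_singleton_of_loops ends t (hloops t ht) v, fun h => by rw [h]; exact mem_openCluster_self _ x⟩
    refine Finset.sum_nonneg fun s hs => ?_
    obtain ⟨hsE, _⟩ := Finset.mem_filter.mp hs
    rw [hsing s (Finset.mem_powerset.mp hsE), hsing (E \ s) Finset.sdiff_subset]
    simp


open Classical in
/-- **REDUCTION THEOREM, class-relative form.**  Let `P ends E x y` be a property of rooted multigraphs (edge/vertex types `ι, V`) that is preserved when a root edge `e = {x,p}`
(`p ∉ {x,y}`) is contracted (`ends ↦ Sym2.map (Function.update id p x) ∘ ends`, `E ↦ E.erase e`).  If the root-contraction inequality (RC) of `noCore_of_rootContraction` holds for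
every member of `P`, then CONJECTURE NO-CORE holds for every member of `P`: `0 ≤ NC_E(x,y)[f,g]` for monotone `f, g` and `y ≠ x`.  (Same induction on `|E|`; e.g. `P` = 'the
multigraph with the edge `xy` added is series–parallel', or any minor-closed class intersected with a root condition.)  [cite: KozmaNitzan2024, Questions 8–9 (§5.5 p. 36) (context)] -/
theorem noCore_of_rootContraction_on (P : (ι → Sym2 V) → Finset ι → V → V → Prop)
    (hP : ∀ (ends : ι → Sym2 V) (E : Finset ι) (e : ι) (x p y : V), e ∈ E → ends e = s(x, p) → p ≠ x → y ≠ p → P ends E x y →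
      P (fun i => Sym2.map (Function.update id p x) (ends i)) (E.erase e) x y)
    (hRC : ∀ (ends : ι → Sym2 V) (E : Finset ι) (e : ι), e ∈ E → ∀ (x p y : V), ends e = s(x, p) → p ≠ x → y ≠ x → y ≠ p →
      (∀ i ∈ E, ends i ≠ s(x, y)) → P ends E x y → ∀ (f g : Set V → ℝ), Monotone f → Monotone g →
      (∑ s ∈ (E.erase e).powerset.filter (fun s : Finset ι =>
          ¬ (y ∈ openCluster (ends '' (↑(insert e s) : Set ι)) x ∧ y ∈ openCluster (ends '' (↑(E \ s) : Set ι)) x)),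
        (f (openCluster (ends '' (↑(insert e s) : Set ι)) x) - f (openCluster (ends '' (↑(E \ s) : Set ι)) x)) *
          (g (openCluster (ends '' (↑(insert e s) : Set ι)) x) - g (openCluster (ends '' (↑(E \ s) : Set ι)) x))) ≤
      ∑ s ∈ E.powerset.filter (fun s : Finset ι => ¬ (y ∈ openCluster (ends '' (↑s : Set ι)) x ∧
            y ∈ openCluster (ends '' (↑(E \ s) : Set ι)) x)),
        (f (openCluster (ends '' (↑s : Set ι)) x) - f (openCluster (ends '' (↑(E \ s) : Set ι)) x)) *
          (g (openCluster (ends '' (↑s : Set ι)) x) - g (openCluster (ends '' (↑(E \ s) : Set ι)) x)))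
    (ends : ι → Sym2 V) (E : Finset ι) (x y : V) (hPE : P ends E x y) (hyx : y ≠ x) (f g : Set V → ℝ) (hf : Monotone f) (hg : Monotone g) :
    0 ≤ ∑ s ∈ E.powerset.filter (fun s : Finset ι => ¬ (y ∈ openCluster (ends '' (↑s : Set ι)) x ∧
          y ∈ openCluster (ends '' (↑(E \ s) : Set ι)) x)),
      (f (openCluster (ends '' (↑s : Set ι)) x) - f (openCluster (ends '' (↑(E \ s) : Set ι)) x)) *
        (g (openCluster (ends '' (↑s : Set ι)) x) - g (openCluster (ends '' (↑(E \ s) : Set ι)) x)) := by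
  induction hn : E.card using Nat.strong_induction_on generalizing E ends f g with
  | _ n ih =>
  by_cases hadj : ∃ i ∈ E, ends i = s(x, y)
  · obtain ⟨i, hi, hixy⟩ := hadj
    exact noCore_powerset_of_adj_root ends E x y hi hixy hyx f g hf hg
  push Not at hadj
  by_cases hroot : ∃ e ∈ E, ∃ p : V, p ≠ x ∧ ends e = s(x, p)
  · obtain ⟨e, he, p, hpx, hxp⟩ := hroot
    have hyp : y ≠ p := by rintro rfl; exact hadj e he hxp
    have hRCe := hRC ends E e he x p y hxp hpx hyx hyp hadj hPE f g hf hg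
    refine le_trans ?_ hRCe
    rw [← noCore_contract_eq ends E he hxp hpx hyp f g]
    have hcard : (E.erase e).card < n := by rw [← hn]; exact Finset.card_erase_lt_of_mem he
    have hf' : Monotone (fun X : Set V => f (insert p X)) := fun X Y hXY => hf (Set.insert_subset_insert hXY)
    have hg' : Monotone (fun X : Set V => g (insert p X)) := fun X Y hXY => hg (Set.insert_subset_insert hXY)
    exact ih _ hcard (fun i => Sym2.map (Function.update id p x) (ends i)) (E.erase e) (hP ends E e x p y he hxp hpx hyp hPE)
      (fun X => f (insert p X)) (fun X => g (insert p X)) hf' hg' rfl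
  · push Not at hroot
    have hloops : ∀ t : Finset ι, t ⊆ E → ∀ i ∈ t, ∀ w : V, ends i = s(x, w) → w = x := by
      intro t ht i hi w hiw
      by_contra hwx
      exact hroot i (ht hi) w hwx hiw
    have hsing : ∀ t : Finset ι, t ⊆ E → openCluster (ends '' (↑t : Set ι)) x = {x} := by
      intro t ht
      ext v
      simp only [Set.mem_singleton_iff]
      exact ⟨openCluster_subset_singleton_of_loops ends t (hloops t ht) v, fun h => by rw [h]; exact mem_openCluster_self _ x⟩
    refine Finset.sum_nonneg fun s hs => ?_
    obtain ⟨hsE, _⟩ := Finset.mem_filter.mp hs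
    rw [hsing s (Finset.mem_powerset.mp hsE), hsing (E \ s) Finset.sdiff_subset]
    simp

end sums

end Coefficientwise

end Summit.CriticalPhenomena.PercolationContinuityZ3.Theorems
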